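import Summits.BirchSwinnertonDyer.Rank1Residual.X4.KolyvaginIndexRecordsKitOddPrime
import HarnessLib

/-!
# BSD rank-≤1 residual cell, lane class X11b (`p ∥ N`: MULTIPLICATIVE at a prime `p ≥ 5`, `ρ̄_{E,p}` onto), rank ONE, KOLY-shaped: `BSD(E,p)`
# PER CELL from PUBLISHED theorems + Kolyvagin's HEEGNER-INDEX certificate `p ∤ [E(K):ℤy_K]` (two engines) through the unit's GEN 27 kit
# `X4.bsdp_prime_of_kolyvaginIndex_of_serreCounts`, `ρ̄_{E,p}` onto IN THE KERNEL — records 01 (x11c GEN 36 «J1-REMAINDER / KOLY-R»)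

HONEST FRAMING (cell `b2b-bsdres-*`, verbatim): prove what is provable now; shrink each hard class to its core with data; no claim beyond
stated classes; COMBINATION classes deleted from PUBLISHED theorems only, CONSTRUCTION-shaped remainder typed; this is not "finishing BSD".
X4 / X11b (and X11 ∧ r = 1 ∧ p = 3) stay CONSTRUCTION-SHAPED; everything here is PER CELL; no lane verdict is changed; NO named fact is
introduced (debt 0) and NO definition; nothing is booked by this file (bookings are referee A's, pub-bsdpct); Cremona's numbers (`r_an`,
`#Ш_an`, models, generators, `∏ c_ℓ`, torsion, optimality / Manin codes, the galrep datum) and the Kurihara lane's per-prime tables are INPUTS.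

Unit `b2b-bsdres-x11c`, GEN 36 (prover-b2b-bsdres-x11c-g36-0), move «J1-REMAINDER / KOLY-R». POPULATION (`HOME/b2b-bsdres-x11c/gen36/pop/`:
`census36.py` over referee A's ROUND 983 state of record × the Kurihara lane's sweep records × Cremona, then `build_pop36.py`): EVERY live
residue cell on the Kolyvagin / Jetchev road classes (X4, X7, X8, X11a, X11b), BOTH ranks, odd `p`, whose shape is KOLY (`ρ̄_{E,p}` onto,
`p ∤ #E(ℚ)_tors·∏c·#Ш_an`: 30 cells) or J1 (onto, `p ∤ #E(ℚ)_tors·#Ш_an`, exactly ONE prime `q ∣ N` with `p ∣ c_q`: 171 cells; the two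
J1 cells whose carrier is an ADDITIVE `p` have no door and are excluded) — 199 cells on 191 classes (188 of them with this cell as their ONLY
open cell): 82 rank-one `(3, X11b)`, 59 `(5, X4)` + 2 `(7, X4)` (rank one 19 / rank zero 42), 26 `(3, X4)` J1 (1 / 25), 20 `(3, X4)` KOLY
(6 / 14), 10 KOLY at `p ≥ 5`. The lane never certified them: at rank one its Heegner fields (`|D| ≤ 1511`) read `ord_p [E(K):ℤy_K] = w + 1`
or found no admissible field; at rank zero (additive `p`) no Heegner-index line was ever run. THIS UNIT ran the cell's engines VERBATIM in
DEEPER fields: engine 1 = gen 3 `engine1_cha1b/main.py` = x9-g7 `jobD1b.py` (cypari2, sha256 `69e29ec7…`; rank-one mode: Cremona's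
generator, `hy = L'(E,1)·L(E^D,1)·√|D|/(4·Area)`, `m = √(4·hy/ĥ(P))`; rank-zero mode: the rank-one twist `F = E^D`, a point `x ∈ F(ℚ)` by
`ellrank`, saturated, `hy = L(E,1)·L'(F,1)·√|D|/(4·Area)`, `m = √(4·hy/ĥ(x))` — Miller 2011 Thm. 4.1 / Cor. 4.8; `NDISC 16`, `DBOUND 6000`);
engine 2 = gen 3 `run_cert.py` (`1b54bb20…`) + `e2lib.py` + `tate_stdlib.py` (stdlib re-implementation: `m`, `ord_p m` must be EQUAL,
discrete checks); twist values = additive-p1 `twistvals/main.py` (`e501b988…`). Kit jobs: see HOME/b2b-bsdres-x11c/gen36/harvest/JOBS-gen36.txt. Evidence `HOME/b2b-bsdres-x11c/gen36/`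
(POP36.md, ROWS36-TABLE.md, harvest outputs with inputs.sha256, SHA256SUMS); REPORT.md §45.

THE ROAD (the unit's GEN 26/27/32 Kolyvagin route, class-agnostic, at `p ≥ 5`; referee A booked its X11b / X4 / X7 rows flag-free at pub-bsdpct
ROUNDS 429 / 651 / 835 / 839 in the KOLYD-r1 grammar): Kolyvagin's theorem as PRINTED by McCallum (LMS LN 153 (1991) §1) / Gross (ibid., Prop. 2.1 (2)) —
tree named facts `kolyvagin`, `Kolyvagin1990_padicValNat_card_sha_le` (registry A20; NOTHING about the reduction of `E` at `p`): `p ∤ [E(K):ℤy_K]` ⇒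
`Ш(E/K)[p] = 0` ⇒ `Ш(E/ℚ)[p] = 0`, and with `ord_p #Ш_an = 0` Miller's `BSD(E,p)` (`Typed.bsdp_of_kolyvagin_of_not_dvd_index`, `r_an ≤ 1`).
IN THE KERNEL per cell (kit `X4.bsdp_prime_of_kolyvaginIndex_of_serreCounts`, `X4/KolyvaginIndexRecordsKitOddPrime.lean`, p391900; every numeric
hypothesis a `decide` goal): `Δ ≠ 0`; global minimality of Cremona's model (bounded Kraus criterion, `|Δ| < 512¹²`); `ρ̄_{E,p}` ONTO by Serre's
Prop. 19 from THREE witness primes (schema point counts). DISPLAYED (binders, LETTER FOR LETTER the tuple of the unit's `X11b.bsdp_k<label>_<p>` /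
`X4.bsdp_k<label>_<p>` records): `hGZK`, `hKo` / `hB`, the Heegner datum (`K`, level `N`, `P` of infinite order, `p ∤ [E(K):ℤP]` — THIS UNIT's
two-engine datum, quoted per docstring, NOT re-computed here), `r_an ≤ 1`, `#Ш_an = q` with `ord_p q = 0`.
What a record is worth is the referee's call (EVIDENCE-grade certificate under displayed binders, as every Heegner-index record of the
cell). Cells in this file: `456330b1`@5, `488070ek1`@5, `456330b1`@7, `488070ek1`@11, `488070ek1`@17, `488070ek1`@29, `456330b1`@41.

References: D. Jetchev, Compos. Math. 144 (2008) Thm. 1.4, Cor. 1.5 [Jetchev2008]; W. McCallum, LMS LN 153 (1991) §1, Cor. 5.6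
[McCallumLMS1991]; B. H. Gross, LMS LN 153 (1991) Prop. 2.1 [GrossLMS1991]; V. A. Kolyvagin (1990) [KolyvaginEulerSystems1990];
J.-P. Serre, Invent. Math. 15 (1972) §2.4 Prop. 15, §2.8 Prop. 19 [Serre1972]; J.-P. Serre, *Abelian ℓ-adic representations* IV-23
[SerreAbelianLadic1968]; B. H. Gross, D. Zagier, Invent. Math. 84 (1986) [GrossZagier1986]; R. L. Miller, LMS J. Comput. Math. 14 (2011)
Thm. 4.1, Cor. 4.8, Def. 1.1 [Miller2011LMS]; C. Wuthrich, Doc. Math. 19 (2014) Lemma 20 [Wuthrich2014]; J. H. Silverman, *AEC* (2009)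
VII.1, VII.5 [SilvermanAEC2009], *ATAEC* (1994) IV.9.4 [SilvermanATAEC1994]; A. Kraus, Acta Arith. 54 (1989) [Kraus1989]; Cremona's
tables [Cremona2006].
-/

set_option autoImplicit false

noncomputable section

open scoped Classical

open WeierstrassCurve Literature.NumberTheory.EllipticCurves
  Literature.NumberTheory.EllipticCurves.Rank1Residual
  Literature.NumberTheory.EllipticCurves.Rank1Residual.Typed
  Literature.NumberTheory.EllipticCurves.Rank1Residual.X11RankOneCertificates
  Summit.BirchSwinnertonDyer.BirchSwinnertonDyer.Rank1Residual.IntModel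
  Summit.BirchSwinnertonDyer.BirchSwinnertonDyer.Rank1Residual.X11RankOne
  Summit.BirchSwinnertonDyer.Rank1Residual.X4

namespace Summit.BirchSwinnertonDyer.Rank1Residual.X11b

/-- **`BSD(E,5)` for `456330b1`** (cell `(456330b1, 5)`, class X11b, rank 1; KOLYD grammar key `KOLY:456330b1@5`); `N = 456330 = 2·3·5·7·41·53`,
nonsplit `I4` at `5`, `r_an = 1`, `#E(ℚ)_tors = 2`, `∏c = 48`, `#Ш_an = 1`, Cremona galrep: no code at this prime (`ρ̄_{E,5}` onto); `|Δ| = ∏` over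
`[(2, 10), (3, 7), (5, 4), (7, 2), (41, 6), (53, 1)]` (factored Kraus criterion, every disjunct decided). KOLY-shaped: `5 ∤ #E(ℚ)_tors·∏c·#Ш_an`;
door `X4.bsdp_prime_of_kolyvaginIndex_of_serreCounts` (the unit's GEN 27 kit, class-agnostic: Kolyvagin as printed, `5 ∤ [E(K):ℤy_K]` ⇒ `Ш(E/ℚ)[5] =
0`; bounded Kraus minimality `|Δ| < 512¹²`); displayed certificate line `hI : ¬ 5 ∣ [E(K):ℤP]`. Serre Prop-19 witnesses mod `5`: (i) `ℓ₁ = 13`, `#Ẽ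
= 20`, `r = 2`; (ii) `ℓ₂ = 17`, `#Ẽ = 12`; (iii) `ℓ₃ = 17`, `#Ẽ = 12`, `u = 3`. Kurihara lane note of record: «multiplicative p, r=1, irr (Castella
2018 Thm A withdrawn for p||N)». State of record (referee A ROUND 983, `scratchA_A_state_after_x4gh_add3_onA2R977_fold.pkl`): class `residue`, 5
open cell(s), register ('JSW-ss', 'tail'). FLAG `opt-code-2` (Cremona optimality code 2; `ρ̄_{E,5}` onto forbids a `5`-isogeny in the class, so
`ord_5` of the index is class-invariant; the reading stands if the optimal curve's Manin constant is prime to `5`). Other engine-1 fields tried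
(`D`: `m` (`ord_5 m`)): none. THIS UNIT'S DATUM (displayed, NOT re-computed here): DEEP FIELD `K = ℚ(√-1679)` (`1679` = 23·73): **`m = [E(K):ℤy_K] =
288`, `ord_5 m = 0`** (`ρ = m²/4`, `L'(E,1) = 2.3504516266`, `L(E^D,1) = 4.2471067543`, `ĥ(P) = 1.8121232417`; Cremona's generator) — engine 1
j293239 = engine 2 j294065: `m = 288` EQUAL (AGREE v_p(m)=0, dev ≤ 1.9e-13); twist `E^D` (j294066): `N = 1286412979530`, `#tors·∏c·#Ш_an =
2·384·36`, `ord_5 #Ш_an(E^D) = 0`, `ord_5 ∏c(E^D) = 0` (BSD-consistent). CONDITIONAL on every binder; per cell; nothing booked by this file.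
[cite: McCallumLMS1991, §1 Theorem (Kolyvagin), p. 296] [cite: GrossLMS1991, §2 Prop. 2.1 (2)] [cite: Serre1972, §2.8 Prop. 19] [cite: Cremona2006, Table 1 (label 456330b1)] -/
theorem bsdp_k456330b1_5 (hGZK : rank_eq_analyticRank_of_analyticRank_le_one) (W : WeierstrassCurve ℚ)
    (hW : W = ⟨1, 1, 0, -3636843, 6861071997⟩) {N : ℕ} [NeZero N] {K : Type} [Field K] [NumberField K]
    (hKo : kolyvagin N W K) (hB : Kolyvagin1990_padicValNat_card_sha_le N W K) (hK : IsImaginaryQuadratic K)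
    (hH : SatisfiesHeegnerHypothesis N K) {P : (W.baseChange K).toAffine.Point} (hP : IsHeegnerPoint N W K P)
    (hnt : ¬ IsOfFinAddOrder P) (hI : ¬ 5 ∣ (AddSubgroup.zmultiples P).index) (hr : W.analyticRank ≤ 1)
    {q : ℚ} (hq : shaAn W = (q : ℂ)) (hv : padicValRat 5 q = 0) : BSDp W 5 :=
  bsdp_prime_of_kolyvaginIndex_of_serreCounts 5 (by norm_num) (by norm_num) 1 1 0 (-3636843) 6861071997 (by decide +kernel)
    (by decide +kernel) (by decide +kernel) 13 17 17 (by norm_num) (by norm_num) (by norm_num) (by norm_num)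
    (by norm_num) (by norm_num) (by norm_num) (by norm_num) (by norm_num) (by decide +kernel) (by decide +kernel)
    (by decide +kernel) (n₁ := 20) (n₂ := 12) (n₃ := 12) (hc₁ := by decide +kernel) (hc₂ := by decide +kernel)
    (hc₃ := by decide +kernel) (by decide +kernel) (by decide +kernel) (by decide +kernel) hGZK W
    (by rw [hW]; norm_num) hKo hB hK hH hP hnt hI hr hq hv

/-- **`BSD(E,5)` for `488070ek1`** (cell `(488070ek1, 5)`, class X11b, rank 1; KOLYD grammar key `KOLY:488070ek1@5`); `N = 488070 =
2·3^2·5·11·17·29`, split `I4` at `5`, `r_an = 1`, `#E(ℚ)_tors = 2`, `∏c = 2688`, `#Ш_an = 1`, Cremona galrep: no code at this prime (`ρ̄_{E,5}`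
onto); `|Δ| = ∏` over `[(2, 14), (3, 7), (5, 4), (11, 1), (17, 6), (29, 2)]` (factored Kraus criterion, every disjunct decided). KOLY-shaped: `5 ∤
#E(ℚ)_tors·∏c·#Ш_an`; door `X4.bsdp_prime_of_kolyvaginIndex_of_serreCounts` (the unit's GEN 27 kit, class-agnostic: Kolyvagin as printed, `5 ∤
[E(K):ℤy_K]` ⇒ `Ш(E/ℚ)[5] = 0`; bounded Kraus minimality `|Δ| < 512¹²`); displayed certificate line `hI : ¬ 5 ∣ [E(K):ℤP]`. Serre Prop-19 witnesses
mod `5`: (i) `ℓ₁ = 7`, `#Ẽ = 10`, `r = 1`; (ii) `ℓ₂ = 19`, `#Ẽ = 18`; (iii) `ℓ₃ = 23`, `#Ẽ = 22`, `u = 3`. Kurihara lane note of record: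
«multiplicative p, r=1, irr (Castella 2018 Thm A withdrawn for p||N)». State of record (referee A ROUND 983,
`scratchA_A_state_after_x4gh_add3_onA2R977_fold.pkl`): class `residue`, 6 open cell(s), register empty. FLAG `opt-code-2` (Cremona optimality code
2; `ρ̄_{E,5}` onto forbids a `5`-isogeny in the class, so `ord_5` of the index is class-invariant; the reading stands if the optimal curve's Manin
constant is prime to `5`). Other engine-1 fields tried (`D`: `m` (`ord_5 m`)): none. THIS UNIT'S DATUM (displayed, NOT re-computed here): DEEP FIELD
`K = ℚ(√-5279)` (`5279` = prime): **`m = [E(K):ℤy_K] = 5376`, `ord_5 m = 0`** (`ρ = m²/4`, `L'(E,1) = 15.714192097`, `L(E^D,1) = 18.619665619`,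
`ĥ(P) = 0.2271242531`; Cremona's generator) — engine 1 j293228 = engine 2 j293889: `m = 5376` EQUAL (AGREE v_p(m)=0, dev ≤ 1.8e-14); twist `E^D`
(j293892): `N = 13601457156870`, `#tors·∏c·#Ш_an = 2·10752·4`, `ord_5 #Ш_an(E^D) = 0`, `ord_5 ∏c(E^D) = 0` (BSD-consistent). CONDITIONAL on every
binder; per cell; nothing booked by this file.
[cite: McCallumLMS1991, §1 Theorem (Kolyvagin), p. 296] [cite: GrossLMS1991, §2 Prop. 2.1 (2)] [cite: Serre1972, §2.8 Prop. 19] [cite: Cremona2006, Table 1 (label 488070ek1)] -/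
theorem bsdp_k488070ek1_5 (hGZK : rank_eq_analyticRank_of_analyticRank_le_one) (W : WeierstrassCurve ℚ)
    (hW : W = ⟨1, -1, 1, -5138897, -2919226431⟩) {N : ℕ} [NeZero N] {K : Type} [Field K] [NumberField K]
    (hKo : kolyvagin N W K) (hB : Kolyvagin1990_padicValNat_card_sha_le N W K) (hK : IsImaginaryQuadratic K)
    (hH : SatisfiesHeegnerHypothesis N K) {P : (W.baseChange K).toAffine.Point} (hP : IsHeegnerPoint N W K P)
    (hnt : ¬ IsOfFinAddOrder P) (hI : ¬ 5 ∣ (AddSubgroup.zmultiples P).index) (hr : W.analyticRank ≤ 1)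
    {q : ℚ} (hq : shaAn W = (q : ℂ)) (hv : padicValRat 5 q = 0) : BSDp W 5 :=
  bsdp_prime_of_kolyvaginIndex_of_serreCounts 5 (by norm_num) (by norm_num) 1 (-1) 1 (-5138897) (-2919226431) (by decide +kernel)
    (by decide +kernel) (by decide +kernel) 7 19 23 (by norm_num) (by norm_num) (by norm_num) (by norm_num)
    (by norm_num) (by norm_num) (by norm_num) (by norm_num) (by norm_num) (by decide +kernel) (by decide +kernel)
    (by decide +kernel) (n₁ := 10) (n₂ := 18) (n₃ := 22) (hc₁ := by decide +kernel) (hc₂ := by decide +kernel)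
    (hc₃ := by decide +kernel) (by decide +kernel) (by decide +kernel) (by decide +kernel) hGZK W
    (by rw [hW]; norm_num) hKo hB hK hH hP hnt hI hr hq hv

/-- **`BSD(E,7)` for `456330b1`** (cell `(456330b1, 7)`, class X11b, rank 1; KOLYD grammar key `KOLY:456330b1@7`); `N = 456330 = 2·3·5·7·41·53`,
split `I2` at `7`, `r_an = 1`, `#E(ℚ)_tors = 2`, `∏c = 48`, `#Ш_an = 1`, Cremona galrep: no code at this prime (`ρ̄_{E,7}` onto); `|Δ| = ∏` over
`[(2, 10), (3, 7), (5, 4), (7, 2), (41, 6), (53, 1)]` (factored Kraus criterion, every disjunct decided). KOLY-shaped: `7 ∤ #E(ℚ)_tors·∏c·#Ш_an`;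
door `X4.bsdp_prime_of_kolyvaginIndex_of_serreCounts` (the unit's GEN 27 kit, class-agnostic: Kolyvagin as printed, `7 ∤ [E(K):ℤy_K]` ⇒ `Ш(E/ℚ)[7] =
0`; bounded Kraus minimality `|Δ| < 512¹²`); displayed certificate line `hI : ¬ 7 ∣ [E(K):ℤP]`. Serre Prop-19 witnesses mod `7`: (i) `ℓ₁ = 11`, `#Ẽ
= 14`, `r = 3`; (ii) `ℓ₂ = 13`, `#Ẽ = 20`; (iii) `ℓ₃ = 13`, `#Ẽ = 20`, `u = 6`. Kurihara lane note of record: «multiplicative p, r=1, irr (Castella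
2018 Thm A withdrawn for p||N)». State of record (referee A ROUND 983, `scratchA_A_state_after_x4gh_add3_onA2R977_fold.pkl`): class `residue`, 5
open cell(s), register ('JSW-ss', 'tail'). FLAG `opt-code-2` (Cremona optimality code 2; `ρ̄_{E,7}` onto forbids a `7`-isogeny in the class, so
`ord_7` of the index is class-invariant; the reading stands if the optimal curve's Manin constant is prime to `7`). Other engine-1 fields tried
(`D`: `m` (`ord_7 m`)): none. THIS UNIT'S DATUM (displayed, NOT re-computed here): DEEP FIELD `K = ℚ(√-1679)` (`1679` = 23·73): **`m = [E(K):ℤy_K] =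
288`, `ord_7 m = 0`** (`ρ = m²/4`, `L'(E,1) = 2.3504516266`, `L(E^D,1) = 4.2471067543`, `ĥ(P) = 1.8121232417`; Cremona's generator) — engine 1
j293234 = engine 2 j294330: `m = 288` EQUAL (AGREE v_p(m)=0, dev ≤ 1.9e-13); twist `E^D` (j294332): `N = 1286412979530`, `#tors·∏c·#Ш_an =
2·384·36`, `ord_7 #Ш_an(E^D) = 0`, `ord_7 ∏c(E^D) = 0` (BSD-consistent). CONDITIONAL on every binder; per cell; nothing booked by this file.
[cite: McCallumLMS1991, §1 Theorem (Kolyvagin), p. 296] [cite: GrossLMS1991, §2 Prop. 2.1 (2)] [cite: Serre1972, §2.8 Prop. 19] [cite: Cremona2006, Table 1 (label 456330b1)] -/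
theorem bsdp_k456330b1_7 (hGZK : rank_eq_analyticRank_of_analyticRank_le_one) (W : WeierstrassCurve ℚ)
    (hW : W = ⟨1, 1, 0, -3636843, 6861071997⟩) {N : ℕ} [NeZero N] {K : Type} [Field K] [NumberField K]
    (hKo : kolyvagin N W K) (hB : Kolyvagin1990_padicValNat_card_sha_le N W K) (hK : IsImaginaryQuadratic K)
    (hH : SatisfiesHeegnerHypothesis N K) {P : (W.baseChange K).toAffine.Point} (hP : IsHeegnerPoint N W K P)
    (hnt : ¬ IsOfFinAddOrder P) (hI : ¬ 7 ∣ (AddSubgroup.zmultiples P).index) (hr : W.analyticRank ≤ 1)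
    {q : ℚ} (hq : shaAn W = (q : ℂ)) (hv : padicValRat 7 q = 0) : BSDp W 7 :=
  bsdp_prime_of_kolyvaginIndex_of_serreCounts 7 (by norm_num) (by norm_num) 1 1 0 (-3636843) 6861071997 (by decide +kernel)
    (by decide +kernel) (by decide +kernel) 11 13 13 (by norm_num) (by norm_num) (by norm_num) (by norm_num)
    (by norm_num) (by norm_num) (by norm_num) (by norm_num) (by norm_num) (by decide +kernel) (by decide +kernel)
    (by decide +kernel) (n₁ := 14) (n₂ := 20) (n₃ := 20) (hc₁ := by decide +kernel) (hc₂ := by decide +kernel)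
    (hc₃ := by decide +kernel) (by decide +kernel) (by decide +kernel) (by decide +kernel) hGZK W
    (by rw [hW]; norm_num) hKo hB hK hH hP hnt hI hr hq hv

/-- **`BSD(E,11)` for `488070ek1`** (cell `(488070ek1, 11)`, class X11b, rank 1; KOLYD grammar key `KOLY:488070ek1@11`); `N = 488070 =
2·3^2·5·11·17·29`, split `I1` at `11`, `r_an = 1`, `#E(ℚ)_tors = 2`, `∏c = 2688`, `#Ш_an = 1`, Cremona galrep: no code at this prime (`ρ̄_{E,11}`
onto); `|Δ| = ∏` over `[(2, 14), (3, 7), (5, 4), (11, 1), (17, 6), (29, 2)]` (factored Kraus criterion, every disjunct decided). KOLY-shaped: `11 ∤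
#E(ℚ)_tors·∏c·#Ш_an`; door `X4.bsdp_prime_of_kolyvaginIndex_of_serreCounts` (the unit's GEN 27 kit, class-agnostic: Kolyvagin as printed, `11 ∤
[E(K):ℤy_K]` ⇒ `Ш(E/ℚ)[11] = 0`; bounded Kraus minimality `|Δ| < 512¹²`); displayed certificate line `hI : ¬ 11 ∣ [E(K):ℤP]`. Serre Prop-19
witnesses mod `11`: (i) `ℓ₁ = 7`, `#Ẽ = 10`, `r = 3`; (ii) `ℓ₂ = 31`, `#Ẽ = 28`; (iii) `ℓ₃ = 7`, `#Ẽ = 10`, `u = 10`. Kurihara lane note of record: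
«multiplicative p, r=1, irr (Castella 2018 Thm A withdrawn for p||N)». State of record (referee A ROUND 983,
`scratchA_A_state_after_x4gh_add3_onA2R977_fold.pkl`): class `residue`, 6 open cell(s), register empty. FLAG `opt-code-2` (Cremona optimality code
2; `ρ̄_{E,11}` onto forbids a `11`-isogeny in the class, so `ord_11` of the index is class-invariant; the reading stands if the optimal curve's
Manin constant is prime to `11`). Other engine-1 fields tried (`D`: `m` (`ord_11 m`)): none. THIS UNIT'S DATUM (displayed, NOT re-computed here):
DEEP FIELD `K = ℚ(√-5279)` (`5279` = prime): **`m = [E(K):ℤy_K] = 5376`, `ord_11 m = 0`** (`ρ = m²/4`, `L'(E,1) = 15.714192097`, `L(E^D,1) =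
18.619665619`, `ĥ(P) = 0.2271242531`; Cremona's generator) — engine 1 j293239 = engine 2 j294065: `m = 5376` EQUAL (AGREE v_p(m)=0, dev ≤ 1.8e-14);
twist `E^D` (j294066): `N = 13601457156870`, `#tors·∏c·#Ш_an = 2·10752·4`, `ord_11 #Ш_an(E^D) = 0`, `ord_11 ∏c(E^D) = 0` (BSD-consistent).
CONDITIONAL on every binder; per cell; nothing booked by this file.
[cite: McCallumLMS1991, §1 Theorem (Kolyvagin), p. 296] [cite: GrossLMS1991, §2 Prop. 2.1 (2)] [cite: Serre1972, §2.8 Prop. 19] [cite: Cremona2006, Table 1 (label 488070ek1)] -/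
theorem bsdp_k488070ek1_11 (hGZK : rank_eq_analyticRank_of_analyticRank_le_one) (W : WeierstrassCurve ℚ)
    (hW : W = ⟨1, -1, 1, -5138897, -2919226431⟩) {N : ℕ} [NeZero N] {K : Type} [Field K] [NumberField K]
    (hKo : kolyvagin N W K) (hB : Kolyvagin1990_padicValNat_card_sha_le N W K) (hK : IsImaginaryQuadratic K)
    (hH : SatisfiesHeegnerHypothesis N K) {P : (W.baseChange K).toAffine.Point} (hP : IsHeegnerPoint N W K P)
    (hnt : ¬ IsOfFinAddOrder P) (hI : ¬ 11 ∣ (AddSubgroup.zmultiples P).index) (hr : W.analyticRank ≤ 1)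
    {q : ℚ} (hq : shaAn W = (q : ℂ)) (hv : padicValRat 11 q = 0) : BSDp W 11 :=
  bsdp_prime_of_kolyvaginIndex_of_serreCounts 11 (by norm_num) (by norm_num) 1 (-1) 1 (-5138897) (-2919226431) (by decide +kernel)
    (by decide +kernel) (by decide +kernel) 7 31 7 (by norm_num) (by norm_num) (by norm_num) (by norm_num)
    (by norm_num) (by norm_num) (by norm_num) (by norm_num) (by norm_num) (by decide +kernel) (by decide +kernel)
    (by decide +kernel) (n₁ := 10) (n₂ := 28) (n₃ := 10) (hc₁ := by decide +kernel) (hc₂ := by decide +kernel)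
    (hc₃ := by decide +kernel) (by decide +kernel) (by decide +kernel) (by decide +kernel) hGZK W
    (by rw [hW]; norm_num) hKo hB hK hH hP hnt hI hr hq hv

/-- **`BSD(E,17)` for `488070ek1`** (cell `(488070ek1, 17)`, class X11b, rank 1; KOLYD grammar key `KOLY:488070ek1@17`); `N = 488070 =
2·3^2·5·11·17·29`, split `I6` at `17`, `r_an = 1`, `#E(ℚ)_tors = 2`, `∏c = 2688`, `#Ш_an = 1`, Cremona galrep: no code at this prime (`ρ̄_{E,17}`
onto); `|Δ| = ∏` over `[(2, 14), (3, 7), (5, 4), (11, 1), (17, 6), (29, 2)]` (factored Kraus criterion, every disjunct decided). KOLY-shaped: `17 ∤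
#E(ℚ)_tors·∏c·#Ш_an`; door `X4.bsdp_prime_of_kolyvaginIndex_of_serreCounts` (the unit's GEN 27 kit, class-agnostic: Kolyvagin as printed, `17 ∤
[E(K):ℤy_K]` ⇒ `Ш(E/ℚ)[17] = 0`; bounded Kraus minimality `|Δ| < 512¹²`); displayed certificate line `hI : ¬ 17 ∣ [E(K):ℤP]`. Serre Prop-19
witnesses mod `17`: (i) `ℓ₁ = 19`, `#Ẽ = 18`, `r = 8`; (ii) `ℓ₂ = 7`, `#Ẽ = 10`; (iii) `ℓ₃ = 7`, `#Ẽ = 10`, `u = 3`. Kurihara lane note of record: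
«multiplicative p, r=1, irr (Castella 2018 Thm A withdrawn for p||N)». State of record (referee A ROUND 983,
`scratchA_A_state_after_x4gh_add3_onA2R977_fold.pkl`): class `residue`, 6 open cell(s), register empty. FLAG `opt-code-2` (Cremona optimality code
2; `ρ̄_{E,17}` onto forbids a `17`-isogeny in the class, so `ord_17` of the index is class-invariant; the reading stands if the optimal curve's
Manin constant is prime to `17`). Other engine-1 fields tried (`D`: `m` (`ord_17 m`)): none. THIS UNIT'S DATUM (displayed, NOT re-computed here):
DEEP FIELD `K = ℚ(√-5279)` (`5279` = prime): **`m = [E(K):ℤy_K] = 5376`, `ord_17 m = 0`** (`ρ = m²/4`, `L'(E,1) = 15.714192097`, `L(E^D,1) =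
18.619665619`, `ĥ(P) = 0.2271242531`; Cremona's generator) — engine 1 j293228 = engine 2 j293889: `m = 5376` EQUAL (AGREE v_p(m)=0, dev ≤ 1.8e-14);
twist `E^D` (j293892): `N = 13601457156870`, `#tors·∏c·#Ш_an = 2·10752·4`, `ord_17 #Ш_an(E^D) = 0`, `ord_17 ∏c(E^D) = 0` (BSD-consistent).
CONDITIONAL on every binder; per cell; nothing booked by this file.
[cite: McCallumLMS1991, §1 Theorem (Kolyvagin), p. 296] [cite: GrossLMS1991, §2 Prop. 2.1 (2)] [cite: Serre1972, §2.8 Prop. 19] [cite: Cremona2006, Table 1 (label 488070ek1)] -/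
theorem bsdp_k488070ek1_17 (hGZK : rank_eq_analyticRank_of_analyticRank_le_one) (W : WeierstrassCurve ℚ)
    (hW : W = ⟨1, -1, 1, -5138897, -2919226431⟩) {N : ℕ} [NeZero N] {K : Type} [Field K] [NumberField K]
    (hKo : kolyvagin N W K) (hB : Kolyvagin1990_padicValNat_card_sha_le N W K) (hK : IsImaginaryQuadratic K)
    (hH : SatisfiesHeegnerHypothesis N K) {P : (W.baseChange K).toAffine.Point} (hP : IsHeegnerPoint N W K P)
    (hnt : ¬ IsOfFinAddOrder P) (hI : ¬ 17 ∣ (AddSubgroup.zmultiples P).index) (hr : W.analyticRank ≤ 1)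
    {q : ℚ} (hq : shaAn W = (q : ℂ)) (hv : padicValRat 17 q = 0) : BSDp W 17 :=
  bsdp_prime_of_kolyvaginIndex_of_serreCounts 17 (by norm_num) (by norm_num) 1 (-1) 1 (-5138897) (-2919226431) (by decide +kernel)
    (by decide +kernel) (by decide +kernel) 19 7 7 (by norm_num) (by norm_num) (by norm_num) (by norm_num)
    (by norm_num) (by norm_num) (by norm_num) (by norm_num) (by norm_num) (by decide +kernel) (by decide +kernel)
    (by decide +kernel) (n₁ := 18) (n₂ := 10) (n₃ := 10) (hc₁ := by decide +kernel) (hc₂ := by decide +kernel)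
    (hc₃ := by decide +kernel) (by decide +kernel) (by decide +kernel) (by decide +kernel) hGZK W
    (by rw [hW]; norm_num) hKo hB hK hH hP hnt hI hr hq hv

/-- **`BSD(E,29)` for `488070ek1`** (cell `(488070ek1, 29)`, class X11b, rank 1; KOLYD grammar key `KOLY:488070ek1@29`); `N = 488070 =
2·3^2·5·11·17·29`, split `I2` at `29`, `r_an = 1`, `#E(ℚ)_tors = 2`, `∏c = 2688`, `#Ш_an = 1`, Cremona galrep: no code at this prime (`ρ̄_{E,29}`
onto); `|Δ| = ∏` over `[(2, 14), (3, 7), (5, 4), (11, 1), (17, 6), (29, 2)]` (factored Kraus criterion, every disjunct decided). KOLY-shaped: `29 ∤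
#E(ℚ)_tors·∏c·#Ш_an`; door `X4.bsdp_prime_of_kolyvaginIndex_of_serreCounts` (the unit's GEN 27 kit, class-agnostic: Kolyvagin as printed, `29 ∤
[E(K):ℤy_K]` ⇒ `Ш(E/ℚ)[29] = 0`; bounded Kraus minimality `|Δ| < 512¹²`); displayed certificate line `hI : ¬ 29 ∣ [E(K):ℤP]`. Serre Prop-19
witnesses mod `29`: (i) `ℓ₁ = 7`, `#Ẽ = 10`, `r = 11`; (ii) `ℓ₂ = 19`, `#Ẽ = 18`; (iii) `ℓ₃ = 7`, `#Ẽ = 10`, `u = 13`. Kurihara lane note of record: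
«multiplicative p, r=1, irr (Castella 2018 Thm A withdrawn for p||N)». State of record (referee A ROUND 983,
`scratchA_A_state_after_x4gh_add3_onA2R977_fold.pkl`): class `residue`, 6 open cell(s), register empty. FLAG `opt-code-2` (Cremona optimality code
2; `ρ̄_{E,29}` onto forbids a `29`-isogeny in the class, so `ord_29` of the index is class-invariant; the reading stands if the optimal curve's
Manin constant is prime to `29`). Other engine-1 fields tried (`D`: `m` (`ord_29 m`)): none. THIS UNIT'S DATUM (displayed, NOT re-computed here):
DEEP FIELD `K = ℚ(√-5279)` (`5279` = prime): **`m = [E(K):ℤy_K] = 5376`, `ord_29 m = 0`** (`ρ = m²/4`, `L'(E,1) = 15.714192097`, `L(E^D,1) =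
18.619665619`, `ĥ(P) = 0.2271242531`; Cremona's generator) — engine 1 j293234 = engine 2 j294330: `m = 5376` EQUAL (AGREE v_p(m)=0, dev ≤ 1.8e-14);
twist `E^D` (j294332): `N = 13601457156870`, `#tors·∏c·#Ш_an = 2·10752·4`, `ord_29 #Ш_an(E^D) = 0`, `ord_29 ∏c(E^D) = 0` (BSD-consistent).
CONDITIONAL on every binder; per cell; nothing booked by this file.
[cite: McCallumLMS1991, §1 Theorem (Kolyvagin), p. 296] [cite: GrossLMS1991, §2 Prop. 2.1 (2)] [cite: Serre1972, §2.8 Prop. 19] [cite: Cremona2006, Table 1 (label 488070ek1)] -/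
theorem bsdp_k488070ek1_29 (hGZK : rank_eq_analyticRank_of_analyticRank_le_one) (W : WeierstrassCurve ℚ)
    (hW : W = ⟨1, -1, 1, -5138897, -2919226431⟩) {N : ℕ} [NeZero N] {K : Type} [Field K] [NumberField K]
    (hKo : kolyvagin N W K) (hB : Kolyvagin1990_padicValNat_card_sha_le N W K) (hK : IsImaginaryQuadratic K)
    (hH : SatisfiesHeegnerHypothesis N K) {P : (W.baseChange K).toAffine.Point} (hP : IsHeegnerPoint N W K P)
    (hnt : ¬ IsOfFinAddOrder P) (hI : ¬ 29 ∣ (AddSubgroup.zmultiples P).index) (hr : W.analyticRank ≤ 1)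
    {q : ℚ} (hq : shaAn W = (q : ℂ)) (hv : padicValRat 29 q = 0) : BSDp W 29 :=
  bsdp_prime_of_kolyvaginIndex_of_serreCounts 29 (by norm_num) (by norm_num) 1 (-1) 1 (-5138897) (-2919226431) (by decide +kernel)
    (by decide +kernel) (by decide +kernel) 7 19 7 (by norm_num) (by norm_num) (by norm_num) (by norm_num)
    (by norm_num) (by norm_num) (by norm_num) (by norm_num) (by norm_num) (by decide +kernel) (by decide +kernel)
    (by decide +kernel) (n₁ := 10) (n₂ := 18) (n₃ := 10) (hc₁ := by decide +kernel) (hc₂ := by decide +kernel)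
    (hc₃ := by decide +kernel) (by decide +kernel) (by decide +kernel) (by decide +kernel) hGZK W
    (by rw [hW]; norm_num) hKo hB hK hH hP hnt hI hr hq hv

/-- **`BSD(E,41)` for `456330b1`** (cell `(456330b1, 41)`, class X11b, rank 1; KOLYD grammar key `KOLY:456330b1@41`); `N = 456330 = 2·3·5·7·41·53`,
split `I6` at `41`, `r_an = 1`, `#E(ℚ)_tors = 2`, `∏c = 48`, `#Ш_an = 1`, Cremona galrep: no code at this prime (`ρ̄_{E,41}` onto); `|Δ| = ∏` over
`[(2, 10), (3, 7), (5, 4), (7, 2), (41, 6), (53, 1)]` (factored Kraus criterion, every disjunct decided). KOLY-shaped: `41 ∤ #E(ℚ)_tors·∏c·#Ш_an`;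
door `X4.bsdp_prime_of_kolyvaginIndex_of_serreCounts` (the unit's GEN 27 kit, class-agnostic: Kolyvagin as printed, `41 ∤ [E(K):ℤy_K]` ⇒ `Ш(E/ℚ)[41]
= 0`; bounded Kraus minimality `|Δ| < 512¹²`); displayed certificate line `hI : ¬ 41 ∣ [E(K):ℤP]`. Serre Prop-19 witnesses mod `41`: (i) `ℓ₁ = 11`,
`#Ẽ = 14`, `r = 1`; (ii) `ℓ₂ = 19`, `#Ẽ = 28`; (iii) `ℓ₃ = 11`, `#Ẽ = 14`, `u = 19`. Kurihara lane note of record: «multiplicative p, r=1, irr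
(Castella 2018 Thm A withdrawn for p||N)». State of record (referee A ROUND 983, `scratchA_A_state_after_x4gh_add3_onA2R977_fold.pkl`): class
`residue`, 5 open cell(s), register ('JSW-ss', 'tail'). FLAG `opt-code-2` (Cremona optimality code 2; `ρ̄_{E,41}` onto forbids a `41`-isogeny in the
class, so `ord_41` of the index is class-invariant; the reading stands if the optimal curve's Manin constant is prime to `41`). Other engine-1
fields tried (`D`: `m` (`ord_41 m`)): none. THIS UNIT'S DATUM (displayed, NOT re-computed here): DEEP FIELD `K = ℚ(√-1679)` (`1679` = 23·73): **`m =
[E(K):ℤy_K] = 288`, `ord_41 m = 0`** (`ρ = m²/4`, `L'(E,1) = 2.3504516266`, `L(E^D,1) = 4.2471067543`, `ĥ(P) = 1.8121232417`; Cremona's generator) —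
engine 1 j293239 = engine 2 j294065: `m = 288` EQUAL (AGREE v_p(m)=0, dev ≤ 1.9e-13); twist `E^D` (j294066): `N = 1286412979530`, `#tors·∏c·#Ш_an =
2·384·36`, `ord_41 #Ш_an(E^D) = 0`, `ord_41 ∏c(E^D) = 0` (BSD-consistent). CONDITIONAL on every binder; per cell; nothing booked by this file.
[cite: McCallumLMS1991, §1 Theorem (Kolyvagin), p. 296] [cite: GrossLMS1991, §2 Prop. 2.1 (2)] [cite: Serre1972, §2.8 Prop. 19] [cite: Cremona2006, Table 1 (label 456330b1)] -/
theorem bsdp_k456330b1_41 (hGZK : rank_eq_analyticRank_of_analyticRank_le_one) (W : WeierstrassCurve ℚ)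
    (hW : W = ⟨1, 1, 0, -3636843, 6861071997⟩) {N : ℕ} [NeZero N] {K : Type} [Field K] [NumberField K]
    (hKo : kolyvagin N W K) (hB : Kolyvagin1990_padicValNat_card_sha_le N W K) (hK : IsImaginaryQuadratic K)
    (hH : SatisfiesHeegnerHypothesis N K) {P : (W.baseChange K).toAffine.Point} (hP : IsHeegnerPoint N W K P)
    (hnt : ¬ IsOfFinAddOrder P) (hI : ¬ 41 ∣ (AddSubgroup.zmultiples P).index) (hr : W.analyticRank ≤ 1)
    {q : ℚ} (hq : shaAn W = (q : ℂ)) (hv : padicValRat 41 q = 0) : BSDp W 41 :=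
  bsdp_prime_of_kolyvaginIndex_of_serreCounts 41 (by norm_num) (by norm_num) 1 1 0 (-3636843) 6861071997 (by decide +kernel)
    (by decide +kernel) (by decide +kernel) 11 19 11 (by norm_num) (by norm_num) (by norm_num) (by norm_num)
    (by norm_num) (by norm_num) (by norm_num) (by norm_num) (by norm_num) (by decide +kernel) (by decide +kernel)
    (by decide +kernel) (n₁ := 14) (n₂ := 28) (n₃ := 14) (hc₁ := by decide +kernel) (hc₂ := by decide +kernel)
    (hc₃ := by decide +kernel) (by decide +kernel) (by decide +kernel) (by decide +kernel) hGZK W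
    (by rw [hW]; norm_num) hKo hB hK hH hP hnt hI hr hq hv

end Summit.BirchSwinnertonDyer.Rank1Residual.X11b

end
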